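import Literature.RingTheory.Elimination.PerturbedCharpolyDegrees
import Literature.Computability.AlgebraicComplexity.BurgisserPerturbedCharpolyHeightParam
import Literature.Computability.AlgebraicComplexity.BurgisserBooleanPartsA3Steps

/-!
# LangWeilTransfer, support item `TameResolution` (stmt-ValiantsHypothesis-6378) — degree and
# weight of the universal eliminant

Route `LangWeilTransfer` of `ValiantsHypothesis` (conditional route; honest framing: bookkeeping,
nothing here bears on VP ≠ VNP). First brick of the QUANTITATIVE pass (roadmap note of val-lit-p6
g9, §1(B)): the universal eliminant `𝒬 = sLead (pertCharpoly (d+1) F u (1 + n d + 1))` of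
`eliminant_identity` — `F_i = Σ_k α_{ik} S_k`, `u = Σ_j Λ_j X_j` over `ℤ[T ⊔ Λ ⊔ α]` — has

* `U`-degree `≤ (d+1)ⁿ` (`natDegree_universalEliminant_le`, tree `natDegree_sLead_pertCharpoly_le`);
* coefficients of total degree `≤ (d+1)ⁿ (1 + k₀ (d_T + 1))` in `T ⊔ Λ ⊔ α`
  (`totalDegree_coeff_universalEliminant_le`, from the degree calculus
  `totalDegree_coeff_sLead_pertCharpoly_le`), where `d_T` bounds the `T`-degrees of the
  coefficients of the `S_k`;
* coefficients of weight `≤ (1 + (1 + t w₁)^{k₀} n)^{(d+1)ⁿ}`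
  (`weight_coeff_universalEliminant_le`, from `weight_coeff_sLead_pertCharpoly_le`), where `w₁`
  bounds the flattened weights `Σ_β wt(coeff_β S_k)`.
-/

noncomputable section

open MvPolynomial
open Literature.RingTheory.Elimination Literature.Computability.AlgebraicComplexity

-- the summit and the problem share the name `ValiantsHypothesis` (D-0017 single-conjunct layout)
set_option linter.dupNamespace false

namespace Summit.ValiantsHypothesis.ValiantsHypothesis.Theorems.LangWeilTransfer

variable {r n t d : ℕ}

/-- `U`-degree of the universal eliminant: `≤ (d+1)ⁿ`. -/
theorem natDegree_universalEliminant_le (S : Fin t → MvPolynomial (Fin n) (MvPolynomial (Fin r) ℤ)) (k₀ : ℕ) :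
    let ι := Fin r ⊕ (Fin n ⊕ (Fin n × Fin t))
    let F : Fin n → MvPolynomial (Fin n) (MvPolynomial ι ℤ) := fun i =>
      ∑ k, C (X (Sum.inr (Sum.inr (i, k)))) *
        MvPolynomial.map (rename (Sum.inl : Fin r → ι) : MvPolynomial (Fin r) ℤ →ₐ[ℤ] MvPolynomial ι ℤ).toRingHom (S k)
    let u : MvPolynomial (Fin n) (MvPolynomial ι ℤ) := ∑ j, C (X (Sum.inr (Sum.inl j))) * X j
    (sLead (pertCharpoly (d + 1) F u k₀)).natDegree ≤ (d + 1) ^ n := by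
  intro ι F u
  exact natDegree_sLead_pertCharpoly_le (d + 1) F u k₀

/-- The coefficients of `F_i = Σ_k α_{ik} S_k`: `coeff_β F_i = Σ_k α_{ik} · coeff_β S_k`. -/
theorem coeff_universalF (S : Fin t → MvPolynomial (Fin n) (MvPolynomial (Fin r) ℤ)) (i : Fin n)
    (β : Fin n →₀ ℕ) :
    let ι := Fin r ⊕ (Fin n ⊕ (Fin n × Fin t))
    coeff β (∑ k, C (X (Sum.inr (Sum.inr (i, k)) : ι)) *
        MvPolynomial.map (rename (Sum.inl : Fin r → ι) : MvPolynomial (Fin r) ℤ →ₐ[ℤ] MvPolynomial ι ℤ).toRingHom (S k)) =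
      ∑ k, X (Sum.inr (Sum.inr (i, k))) * rename (Sum.inl : Fin r → ι) ((S k).coeff β) := by
  intro ι
  rw [coeff_sum]
  refine Finset.sum_congr rfl fun k _ => ?_
  rw [coeff_C_mul, coeff_map]
  rfl

/-- The coefficients of `u = Σ_j Λ_j X_j`. -/
theorem coeff_universalU (β : Fin n →₀ ℕ) :
    let ι := Fin r ⊕ (Fin n ⊕ (Fin n × Fin t))
    coeff β (∑ j, C (X (Sum.inr (Sum.inl j) : ι)) * (X j : MvPolynomial (Fin n) (MvPolynomial ι ℤ))) =
      ∑ j, if Finsupp.single j 1 = β then X (Sum.inr (Sum.inl j)) else 0 := by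
  intro ι
  classical
  rw [coeff_sum]
  refine Finset.sum_congr rfl fun j _ => ?_
  rw [coeff_C_mul, coeff_X]
  split_ifs <;> simp

/-- **Degrees of the universal eliminant's coefficients.** If the `T`-coefficients of every `S_k`
have total degree `≤ d_T`, the coefficients of `𝒬` have total degree `≤ (d+1)ⁿ (1 + k₀ (d_T + 1))`
in `T ⊔ Λ ⊔ α`. -/
theorem totalDegree_coeff_universalEliminant_le (S : Fin t → MvPolynomial (Fin n) (MvPolynomial (Fin r) ℤ))
    {dT : ℕ} (hST : ∀ k β, ((S k).coeff β).totalDegree ≤ dT) (k₀ j : ℕ) :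
    let ι := Fin r ⊕ (Fin n ⊕ (Fin n × Fin t))
    let F : Fin n → MvPolynomial (Fin n) (MvPolynomial ι ℤ) := fun i =>
      ∑ k, C (X (Sum.inr (Sum.inr (i, k)))) *
        MvPolynomial.map (rename (Sum.inl : Fin r → ι) : MvPolynomial (Fin r) ℤ →ₐ[ℤ] MvPolynomial ι ℤ).toRingHom (S k)
    let u : MvPolynomial (Fin n) (MvPolynomial ι ℤ) := ∑ j, C (X (Sum.inr (Sum.inl j))) * X j
    ((sLead (pertCharpoly (d + 1) F u k₀)).coeff j).totalDegree ≤ (d + 1) ^ n * (1 + k₀ * (dT + 1)) := by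
  intro ι F u
  classical
  have hF : ∀ i β, ((F i).coeff β).totalDegree ≤ dT + 1 := by
    intro i β
    have h := coeff_universalF S i β
    simp only at h
    change ((F i).coeff β).totalDegree ≤ dT + 1
    rw [show (F i).coeff β = ∑ k, X (Sum.inr (Sum.inr (i, k))) * rename (Sum.inl : Fin r → ι) ((S k).coeff β)
      from h]
    refine totalDegree_finsetSum_le fun k _ => ?_
    refine (totalDegree_mul _ _).trans ?_
    rw [totalDegree_X, add_comm]
    exact Nat.add_le_add_right ((totalDegree_rename_le _ _).trans (hST k β)) 1
  have hu : ∀ β, (u.coeff β).totalDegree ≤ 1 := by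
    intro β
    have h := coeff_universalU (r := r) (n := n) (t := t) β
    simp only at h
    change (u.coeff β).totalDegree ≤ 1
    rw [show u.coeff β = ∑ j, if Finsupp.single j 1 = β then X (Sum.inr (Sum.inl j) : ι) else 0 from h]
    refine totalDegree_finsetSum_le fun j _ => ?_
    split_ifs
    · rw [totalDegree_X]
    · rw [totalDegree_zero]; exact Nat.zero_le _
  exact totalDegree_coeff_sLead_pertCharpoly_le F hF u hu k₀ j

/-- **Weights of the universal eliminant's coefficients.** If the flattened weights
`Σ_β wt(coeff_β S_k)` are `≤ w₁`, the coefficients of `𝒬` have weight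
`≤ (1 + (1 + t w₁)^{k₀} · n)^{(d+1)ⁿ}`. -/
theorem weight_coeff_universalEliminant_le (S : Fin t → MvPolynomial (Fin n) (MvPolynomial (Fin r) ℤ))
    {w₁ : ℕ} (hSw : ∀ k, ((S k).support.sum fun β => weight ((S k).coeff β)) ≤ w₁) (k₀ j : ℕ) :
    let ι := Fin r ⊕ (Fin n ⊕ (Fin n × Fin t))
    let F : Fin n → MvPolynomial (Fin n) (MvPolynomial ι ℤ) := fun i =>
      ∑ k, C (X (Sum.inr (Sum.inr (i, k)))) *
        MvPolynomial.map (rename (Sum.inl : Fin r → ι) : MvPolynomial (Fin r) ℤ →ₐ[ℤ] MvPolynomial ι ℤ).toRingHom (S k)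
    let u : MvPolynomial (Fin n) (MvPolynomial ι ℤ) := ∑ j, C (X (Sum.inr (Sum.inl j))) * X j
    weight ((sLead (pertCharpoly (d + 1) F u k₀)).coeff j) ≤ (1 + (1 + t * w₁) ^ k₀ * n) ^ ((d + 1) ^ n) := by
  intro ι F u
  classical
  have hXw : ∀ v : ι, weight (X v : MvPolynomial ι ℤ) = 1 := fun v => by
    rw [show (X v : MvPolynomial ι ℤ) = monomial (Finsupp.single v 1) 1 from rfl, weight_monomial]; rfl
  -- weights of the coefficients of `F`
  have hW : ∀ i, ((F i).support.sum fun β => weight ((F i).coeff β)) ≤ 1 + t * w₁ := by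
    intro i
    have hterm : ∀ β, weight ((F i).coeff β) ≤ ∑ k, weight ((S k).coeff β) := by
      intro β
      have h := coeff_universalF S i β
      simp only at h
      change weight ((F i).coeff β) ≤ _
      rw [show (F i).coeff β = ∑ k, X (Sum.inr (Sum.inr (i, k))) * rename (Sum.inl : Fin r → ι) ((S k).coeff β)
        from h]
      refine (weight_finset_sum_le _ _).trans (Finset.sum_le_sum fun k _ => ?_)
      refine (weight_mul_le _ _).trans ?_
      rw [hXw, one_mul, weight_rename_of_injective Sum.inl_injective]
    calc ((F i).support.sum fun β => weight ((F i).coeff β))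
        ≤ (F i).support.sum fun β => ∑ k, weight ((S k).coeff β) := Finset.sum_le_sum fun β _ => hterm β
      _ = ∑ k, (F i).support.sum fun β => weight ((S k).coeff β) := Finset.sum_comm
      _ ≤ ∑ k, (S k).support.sum fun β => weight ((S k).coeff β) := by
          refine Finset.sum_le_sum fun k _ => ?_
          rw [← Finset.sum_filter_ne_zero ((F i).support)]
          refine Finset.sum_le_sum_of_subset fun β hβ => ?_
          rw [Finset.mem_filter] at hβ
          rw [mem_support_iff]
          intro h0
          exact hβ.2 (by rw [h0, weight_zero])
      _ ≤ ∑ _k : Fin t, w₁ := Finset.sum_le_sum fun k _ => hSw k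
      _ = t * w₁ := by rw [Finset.sum_const, Finset.card_univ, Fintype.card_fin, smul_eq_mul]
      _ ≤ 1 + t * w₁ := Nat.le_add_left _ _
  -- weight of the coefficients of `u`
  have hu : (u.support.sum fun β => weight (u.coeff β)) ≤ n := by
    have hterm : ∀ β, weight (u.coeff β) ≤ ∑ j : Fin n, if Finsupp.single j 1 = β then 1 else 0 := by
      intro β
      have h := coeff_universalU (r := r) (n := n) (t := t) β
      simp only at h
      change weight (u.coeff β) ≤ _
      rw [show u.coeff β = ∑ j, if Finsupp.single j 1 = β then X (Sum.inr (Sum.inl j) : ι) else 0 from h]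
      refine (weight_finset_sum_le _ _).trans (Finset.sum_le_sum fun j _ => ?_)
      split_ifs
      · rw [hXw]
      · rw [weight_zero]
    calc (u.support.sum fun β => weight (u.coeff β))
        ≤ u.support.sum fun β => ∑ j : Fin n, if Finsupp.single j 1 = β then 1 else 0 :=
          Finset.sum_le_sum fun β _ => hterm β
      _ = ∑ j : Fin n, u.support.sum fun β => if Finsupp.single j 1 = β then 1 else 0 := Finset.sum_comm
      _ ≤ ∑ _j : Fin n, 1 := by
          refine Finset.sum_le_sum fun j _ => ?_
          rw [Finset.sum_ite_eq]
          split_ifs <;> simp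
      _ = n := by rw [Finset.sum_const, Finset.card_univ, Fintype.card_fin, smul_eq_mul, mul_one]
  exact weight_coeff_sLead_pertCharpoly_le F (Nat.le_add_right 1 _) hW u hu k₀ j

end Summit.ValiantsHypothesis.ValiantsHypothesis.Theorems.LangWeilTransfer
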